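import Summits.ABC.IUTFork.Cor312TwoPlacePins
import Summits.ABC.IUTFork.Repair.CandInternal2
import Summits.ABC.IUTFork.Repair.CandInternal4
import Summits.ABC.IUTFork.Repair.CandInternal6
import Summits.ABC.IUTFork.Repair.CandMochizuki3
import Summits.ABC.IUTFork.Repair.CandExplicit1
import HarnessLib

/-!
# IUT REPAIR branch (rung LADDER-ABC:A2.RP) — the «2P» COLUMN, part 3 (seat abc-iut-rp-m4): internal (B0), reply (B1) and explicit (B2)
# rows at the pinned two-place bed

Record file of the abc-iut cell's REPAIR branch (seat abc-iut-rp-m4; lead abc-iut-rp-plan). TAKES NO SIDE on [IUTchIII] Cor. 3.12 or on any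
author; PROOF-ONLY; every `H` evaluated is a typed CANDIDATE of its own record file, never asserted here. Companion of `Repair/TwoPlaceProfile`
(p435676) and `TwoPlaceProfile2` (p436352) on the pinned two-place bed (`Cor312TwoPlacePins`, p434789: two places, inflation `(0, 3)`, honest
q-datum, one region operator `rho2`, three pins, typed Thm. 3.11, bridge hypotheses, `|log(q)| > 0`; Statement TRUE, S / Licence FALSE). Cells:
✗ RP-I02a `CandInternal6.H` (datum-level link transport ≡ C) · ✗ RP-I02b `CandInternal6.HR` (≡ S) · ✗ RP-I04 `CandInternal4.H` (INCLUSION form —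
fails by the bed's Θ-type bookkeeping: a subset of a sign-translate of the Θ-pilot's splitting monoid has coordinates `±q^{j²}`, the honest
q-datum has `±q`) · ✓ RP-I09 `CandInternal2.HQPrecise` · ✓ RP-I10 `CandInternal2.HNonInterference` · ✓ RP-M02b `CandMochizuki3.H'`
(= ¬ SingleHolStr: at the inflated place the Θ-region at label `1` has volume `2c ≠ −c`) · ✗ RP-X01b `CandExplicit1.H_Englf` (≡ hull form under the
link pin). READING (neutral): the (LcGlIq)/(EssGlIq) split of S. Mochizuki's [Rpt2024-03] `paper:url-b58939b9dc8f` p. 7 l. 32–44 continues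
row by row — packetwise suppliers (I02a/b, I04, X01b) FALSE, diagnostics (I09, I10, M02b) TRUE. Standard axioms only. [claim: Mochizuki2012, status: disputed]
-/

noncomputable section

open Set

namespace Summit.ABC.IUTFork.Repair.TwoPlaceProfile3

open Thm311 Cor312 Cor312Vol Cor312Vol.TwoPlace Cor312Vol.NaiveProv Literature.IUT.LogThetaLattice

variable (p : ℕ) [hp : Fact p.Prime] (c : ℝ)

/-! ## 1. Internal rows (B0) -/

/-- ✗ **RP-I02a** (`CandInternal6.H`, datum-level link transport by a member of ⟨(Ind1) ∪ (Ind2)⟩ ≡ C ⟹ S): FALSE at 2P. [folklore] -/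
theorem I02a_fails :
    ¬ CandInternal6.H (twoFull p c).toLatticeSituation (twoSetting p c depth) (qDatum p (0 : twoIndex.V) trivial c) :=
  fun h => two_pinned_not_S p c (CandInternal6.S_of_H _ _ (rho2 p depth) _ (two_kummerB p c _) h)

/-- ✗ **RP-I02b** (`CandInternal6.HR`, region-level link transport ≡ S): FALSE at 2P. [folklore] -/
theorem I02b_fails :
    ¬ CandInternal6.HR (twoFull p c).toLatticeSituation (twoSetting p c depth) (rho2 p depth) (qDatum p (0 : twoIndex.V) trivial c) :=
  fun h => two_pinned_not_S p c ((CandInternal6.HR_iff_S _ _ _ _).1 h)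

omit hp in
/-- Θ-type data are closed under passing to sub-data. [folklore] -/
theorem isThetaType_of_subset {X Y : ∀ v : twoIndex.V, v ∈ twoIndex.Vbad → Set ((signShells twoIndex).StarPacket v)}
    (hXY : ∀ (v : twoIndex.V) (hv : v ∈ twoIndex.Vbad), X v hv ⊆ Y v hv) (hY : IsThetaType p Y) : IsThetaType p X :=
  fun v hv ψ hψ j => hY v hv ψ (hXY v hv hψ) j

/-- ✗ **RP-I04** (`CandInternal4.H`, INCLUSION form «qK ⊆ Φ·frobΨ m»): FALSE at 2P — every sign-translate of the Θ-pilot's splitting monoid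
is Θ-type (coordinates `±q^{j²}`), the honest q-datum (coordinates `±q`) is not, and Θ-type passes to sub-data. [folklore] -/
theorem I04_fails : ¬ CandInternal4.H (twoFull p c).toLatticeSituation (twoSetting p c depth) (qDatum p (0 : twoIndex.V) trivial c) := by
  rintro ⟨Φ, hΦ, m, hsub⟩
  rw [two_frobΨ] at hsub
  exact not_isThetaType_qDatum p (0 : twoIndex.V) trivial c
    (isThetaType_of_subset p hsub ((isThetaType_transport_iff p hΦ _).2 (isThetaType_Psi p)))

/-- ✓ **RP-I09** (`CandInternal2.HQPrecise`: the q-pilot image is a hull-set and its log-volume is label-independent): TRUE at 2P (`−c` at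
every label and place). [folklore] -/
theorem I09_holds : CandInternal2.HQPrecise (twoFull p c).toLatticeSituation (twoSetting p c depth) :=
  ⟨(twoSetting p c depth).qRegion_mem, fun i i' vQ => by rw [two_qLocal, two_qLocal]⟩

omit hp in
/-- ✓ **RP-I10** (`CandInternal2.HNonInterference`, inside the typed Thm. 3.11 (ii)): TRUE at 2P. [folklore] -/
theorem I10_holds : CandInternal2.HNonInterference (twoFull p c).toLatticeSituation (twoSetting p c depth) :=
  CandInternal2.hNonInterference_of_partII _ _ (partII_W p _ _)

/-! ## 2. Reply (B1) and explicit (B2) rows -/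

/-- ✓ **RP-M02b** (`CandMochizuki3.H'` = ¬ SingleHolStr, «distinct labels / ring structures»: the Θ-regions are NOT `j²`-scaled copies of the
q-region in log-volume): TRUE at 2P — at the inflated place `1`, label `1`, the Θ-region `B_{1−3}` has volume `2c ≠ 1²·(−c)` (`c > 0`).
[folklore] -/
theorem M02b_holds (hc : 0 < c) :
    CandMochizuki3.H' (twoFull p c).toLatticeSituation (twoSetting p c depth) (rho2 p depth) (qDatum p (0 : twoIndex.V) trivial c) := by
  intro h
  have h1 := h 0 1
  have hΨ : ((twoFull p c).toLatticeSituation.D (twoSetting p c depth).n).Ψ =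
      fun (v : twoIndex.V) (_ : v ∈ twoIndex.Vbad) => PsiOf (thetaVec1 p) v := rfl
  rw [hΨ, rho2_Psi, rho2_qDatum, tE_of_hasBad (two_hasBad 1), qE_of_hasBad (two_hasBad 1) (Setting.labelSucc_ne_zero _)] at h1
  have hv1 : ((twoFull p c).toLatticeSituation.D (twoSetting p c depth).n).logvol (Setting.labelSucc 0) 1
      (pBall p (Setting.labelSucc (T := twoIndex) 0) (1 : twoIndex.VQ)
        (jsq (T := twoIndex) (Setting.labelSucc (T := twoIndex) 0) - (depth 1 : ℕ))) =
      -((jsq (T := twoIndex) (Setting.labelSucc (T := twoIndex) 0) - (depth 1 : ℕ) : ℤ) : ℝ) * c :=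
    volW_pBall p (fun _ : twoIndex.VQ => c) _ (1 : twoIndex.VQ) _
  have hv2 : ((twoFull p c).toLatticeSituation.D (twoSetting p c depth).n).logvol (Setting.labelSucc 0) 1
      (pBall p (Setting.labelSucc (T := twoIndex) 0) (1 : twoIndex.VQ) 1) = -((1 : ℤ) : ℝ) * c :=
    volW_pBall p (fun _ : twoIndex.VQ => c) _ (1 : twoIndex.VQ) 1
  rw [hv1, hv2, two_jsq.1, depth_val.2] at h1
  push_cast at h1
  nlinarith

/-- ✗ **RP-X01b** (`CandExplicit1.H_Englf`, [EssLgc]'s operative sentence at hull level ≡ the hull form under the link pin): FALSE at 2P.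
[folklore] -/
theorem X01b_fails :
    ¬ CandExplicit1.H_Englf (twoFull p c).toLatticeSituation (twoSetting p c depth) (rho2 p depth) (qDatum p (0 : twoIndex.V) trivial c) :=
  fun h => two_not_licence p c
    (licence_of_pilotKummerCompatHull _ _ _ _ (two_pinnedRegions3 p c depth).1.2
      ((CandExplicit1.H_Englf_iff _ _ _ _ (two_pinnedRegions3 p c depth).2).1 h))

/-- **Part 3 of the column, packaged** (`c = log p`). [folklore] -/
theorem twoPlace_column3 :
    ¬ CandInternal6.H (twoFull p (Real.log p)).toLatticeSituation (twoSetting p (Real.log p) depth)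
        (qDatum p (0 : twoIndex.V) trivial (Real.log p)) ∧
      ¬ CandInternal6.HR (twoFull p (Real.log p)).toLatticeSituation (twoSetting p (Real.log p) depth) (rho2 p depth)
        (qDatum p (0 : twoIndex.V) trivial (Real.log p)) ∧
      ¬ CandInternal4.H (twoFull p (Real.log p)).toLatticeSituation (twoSetting p (Real.log p) depth)
        (qDatum p (0 : twoIndex.V) trivial (Real.log p)) ∧
      CandInternal2.HQPrecise (twoFull p (Real.log p)).toLatticeSituation (twoSetting p (Real.log p) depth) ∧
      CandInternal2.HNonInterference (twoFull p (Real.log p)).toLatticeSituation (twoSetting p (Real.log p) depth) ∧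
      CandMochizuki3.H' (twoFull p (Real.log p)).toLatticeSituation (twoSetting p (Real.log p) depth) (rho2 p depth)
        (qDatum p (0 : twoIndex.V) trivial (Real.log p)) ∧
      ¬ CandExplicit1.H_Englf (twoFull p (Real.log p)).toLatticeSituation (twoSetting p (Real.log p) depth) (rho2 p depth)
        (qDatum p (0 : twoIndex.V) trivial (Real.log p)) :=
  have hc : 0 < Real.log p := Real.log_pos (by exact_mod_cast hp.out.one_lt)
  ⟨I02a_fails p _, I02b_fails p _, I04_fails p _, I09_holds p _, I10_holds p _, M02b_holds p _ hc, X01b_fails p _⟩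

end Summit.ABC.IUTFork.Repair.TwoPlaceProfile3

end
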